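/-
Copyright (c) 2026 the pub-hodgecm-mathlib formalisation cell (harness21).  Prover seat hodgecm-mathlib-K2Liu-p14 (g2), Track B «K2-LIT»,
#184♮ = hLiu418 = `stmt-HodgeConjecture-24832`; Road Φ ∕ socket #41, organ G5-a (Φ7-2), face (β0) of LEAD F0P6-plan RULING «M-157b», consumption side
(LEAD BATCH #5 2026-09-04T11:40:22Z «(β0-1b) the adelic Borel-law SHAPE with the unfolding identity as ONE named hypothesis `hunfold`»; K2Liu-p10 (g3) census
11:00:01Z (o1); census K2Liu-p14 (g2) 11:42:27Z; booked K2E5-plan (g7) 11:43:39Z as U1-CT-ind stage-3 sub-row (β0-1b)).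
-/
import Summits.HodgeConjecture.HodgeConjecture.Theorems.K2LiuGL2GodementSectionsExhaustGlobal   -- ★ (β4-iii): `glDiagonal` letters, `det_glDiagonal_two`, `det_eq_one_of_unipotent`
import Mathlib.MeasureTheory.Integral.Bochner.Basic
import HarnessLib

/-!
# Crux `HLiu418`, Road Φ, organ G5-a, face (β0-1b): THE BOREL LAW OF THE INNER SECTION OF THE MIDDLE CELL, FROM THE UNFOLDING IDENTITY —
# `F(Λ(a)·y) = m(a)·σ(w₀Λ(a)w₀⁻¹)·F(y)` for every Levi element `a` normalising the corner coordinate, `F(Λ(u)·y) = F(y)` for the unipotents; and the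
# UNTWISTING of the resulting `GL₂(𝔸)` torus law `(s+1, −s) ⊗ (χ∘det)` into the flat law `(s+½, −(s+½))` of ★ (β)

Cell `hodgecm-mathlib`, crux item hLiu418 = `stmt-HodgeConjecture-24832`; squad K2 ∕ K2Liu; prover K2Liu-p14 (g2).  THEOREMS ONLY (no `def`, no instance, no
notation, no named-fact hypothesis, no `sorry`); lane `--supports stmt-HodgeConjecture-24832 --as helper`.

WHY.  The middle cell of the constant term of the doubled Siegel Eisenstein series is `Σ_{p ∈ ℙ¹(L)} F_s(Λ(γ̂_p)·h)` (★ α3-2 `K2LiuConstantTermMiddleCellGL2.middle_cell_eq_tsum`)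
with inner section `F_s(y) = ∫ β₁(u)•f_s(w₀ u y) dνN(u)`; (β0-1a) (K2Liu-p02∕p10) unfolds it as **`hunfold : F y = c · ∫ f(w₀ · n₂(t) · y) dμ(t)`** over the corner one-parameter
subgroup `n₂ : 𝔸₀ → N_Δ(𝔸)` complementary to `N_χ = Stab_{N_Δ}([w₀])`.  THIS FILE (hypothesis-first, ABSTRACT in the groups: `Λ : G →* H`, `w₀ ∈ H`, `n₂ : A₀ → H`, a Haar-type
measure `μ` on `A₀`, a multiplier law `f(p h) = σ(p) f(h)` on a set `P ⊆ H`, a set `Z ⊆ H` of «invisible» elements with `w₀ Z w₀⁻¹ ⊆ P ∩ {σ = 1}`) derives the Borel law of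
`a ↦ F(Λ(a)·y)`:
* §1 **`inner_law_of_unfold`**: if `Λ(a)⁻¹ n₂(t) Λ(a) = z_t · n₂(act t)` (`z_t ∈ Z`), `∫ φ(act t) dμ = m · ∫ φ dμ` (the Haar scaling of the corner coordinate, BY VALUE) and
  `w₀ Λ(a) w₀⁻¹ ∈ P`, then **`F(Λ(a)·y) = m · σ(w₀Λ(a)w₀⁻¹) · F(y)`**; `inner_law_of_unfold_of_sigma_eq_one` (`m = 1`, `σ = 1`: **`F(Λ(u)·y) = F(y)`** — the unipotents of
  the `GL₂` Borel commute with the corner coordinate modulo `N_χ`).  For the torus `a = diag(d₀, d₁)` the by-value letters are `m(d) = |d₁ d̄₁…|`-type and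
  `σ_s(w₀Λ(diag d)w₀⁻¹) = χ(det_Δ)|det_Δ|^{s+1}` with `det_Δ = d₀ d̄₁⁻¹` (★ α2d-1 `isSiegelDelta_reflStd_conj_levi_map_iff` for membership) — net `χ(d₀d₁)·|d₀|^{s+1}|d₁|^{−s}`
  (CENSUS-41 §8 «`(s′+1, −s′)`»); they are discharged by (β0-1a)'s coordinates, not here.
* §2 (concrete `GL₂(𝔸_L)`): **`untwist_torus_law`** — if `φ₀(diag(d)·g) = ξ(d₀)ξ(d₁)·|d₀|^{s+½}|d₁|^{−(s+½)}·φ₀(g)` for a character `ξ : 𝔸ˣ →* ℂˣ` (here `ξ = χ·|·|^{½}`), then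
  `ψ := ξ(det ·)⁻¹·φ₀` has ★ (β)'s FLAT torus law `hT` (exponents `(s+½, −(s+½))`, no character); **`untwist_unipotent_law`** (`det u = 1`); and the exponent
  bookkeeping **`cpow_shift_half`**: `|d₀|^{s+1}|d₁|^{−s} = (|d₀||d₁|)^{½} · |d₀|^{s+½}|d₁|^{−(s+½)}`.
References: [MoeglinWaldspurger1995, II.1.7 (constant terms along `w⁻¹Pw ∩ N`: the inner integral is a section of the Levi's induced representation)]; [KudlaRallis1994, §2
(2.10)–(2.12)]; [Bump1997, §3.7]; [GelbartPiatetskishapiroRallis1987, Part A §2].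
HONEST LABEL.  Count-neutral helper: `HC_CM` is proved only modulo the 7 printed citations (2 remaining named inputs: hLiu418 = `stmt-HodgeConjecture-24832`,
h413 = `stmt-HodgeConjecture-24833`) until rung 0 closes.
-/

set_option autoImplicit false
set_option linter.dupNamespace false -- the mandated namespace repeats `HodgeConjecture.HodgeConjecture`

noncomputable section

open MeasureTheory NumberField IsDedekindDomain
open scoped Matrix
open Literature.NumberTheory.Automorphic
open Summit.HodgeConjecture.HodgeConjecture.Cruxes.HLiu418.K2LiuGL2GodementSectionsExhaustGlobal (det_glDiagonal_two det_eq_one_of_unipotent)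

namespace Summit.HodgeConjecture.HodgeConjecture.Cruxes.HLiu418.K2LiuMiddleInnerSectionBorelLaw

/-! ## §1 The Borel law of `a ↦ F(Λ(a)·y)` from the unfolding identity -/

section Abstract

variable {G H A₀ : Type*} [Group G] [Group H] [MeasurableSpace A₀]

omit [MeasurableSpace A₀] in
/-- the integrand rewritten along `Λ(a)`: `w₀ · n₂(t) · (Λa · y) = (w₀ Λa w₀⁻¹) · (w₀ z_t w₀⁻¹) · (w₀ · n₂(act t) · y)`. [folklore] -/
theorem conj_rewrite (Λ : G →* H) (w₀ : H) (n₂ : A₀ → H) (a : G) (act : A₀ → A₀) {t : A₀} {z : H}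
    (hz : (Λ a)⁻¹ * n₂ t * Λ a = z * n₂ (act t)) (y : H) :
    w₀ * n₂ t * (Λ a * y) = (w₀ * Λ a * w₀⁻¹) * ((w₀ * z * w₀⁻¹) * (w₀ * n₂ (act t) * y)) := by
  have h1 : n₂ t * Λ a = Λ a * (z * n₂ (act t)) := by
    rw [← hz]
    group
  calc w₀ * n₂ t * (Λ a * y) = w₀ * (n₂ t * Λ a) * y := by group
    _ = w₀ * (Λ a * (z * n₂ (act t))) * y := by rw [h1]
    _ = (w₀ * Λ a * w₀⁻¹) * ((w₀ * z * w₀⁻¹) * (w₀ * n₂ (act t) * y)) := by group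

/-- **(β0-1b) THE BOREL LAW OF THE INNER SECTION FROM THE UNFOLDING.**  Let `F(y) = c · ∫ f(w₀ · n₂(t) · y) dμ(t)` (`hunfold`), `f(p h) = σ(p) f(h)` for `p ∈ P` (`hf`),
`w₀ Z w₀⁻¹ ⊆ P ∩ {σ = 1}` (`hZ`).  If `Λ(a)` normalises the corner coordinate modulo `Z` — `Λ(a)⁻¹ n₂(t) Λ(a) = z_t · n₂(act t)`, `z_t ∈ Z` — with Haar scaling
`∫ φ(act t) dμ = m · ∫ φ dμ`, and `w₀ Λ(a) w₀⁻¹ ∈ P`, then **`F(Λ(a) · y) = m · σ(w₀ Λ(a) w₀⁻¹) · F(y)`**. [cite: MoeglinWaldspurger1995, II.1.7] [cite: KudlaRallis1994, §2] -/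
theorem inner_law_of_unfold (μ : Measure A₀) (Λ : G →* H) (w₀ : H) (n₂ : A₀ → H) (f F : H → ℂ) (c : ℂ)
    (hunfold : ∀ y, F y = c * ∫ t, f (w₀ * n₂ t * y) ∂μ)
    (σ : H → ℂ) (P : Set H) (hf : ∀ p ∈ P, ∀ h, f (p * h) = σ p * f h)
    (Z : Set H) (hZ : ∀ z ∈ Z, w₀ * z * w₀⁻¹ ∈ P ∧ σ (w₀ * z * w₀⁻¹) = 1)
    (a : G) (act : A₀ → A₀) (m : ℂ) (hconj : ∀ t, ∃ z ∈ Z, (Λ a)⁻¹ * n₂ t * Λ a = z * n₂ (act t))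
    (hscale : ∀ φ : A₀ → ℂ, ∫ t, φ (act t) ∂μ = m * ∫ t, φ t ∂μ) (hP : w₀ * Λ a * w₀⁻¹ ∈ P) (y : H) :
    F (Λ a * y) = m * σ (w₀ * Λ a * w₀⁻¹) * F y := by
  have hint : (fun t => f (w₀ * n₂ t * (Λ a * y))) = fun t => σ (w₀ * Λ a * w₀⁻¹) * f (w₀ * n₂ (act t) * y) := by
    funext t
    obtain ⟨z, hzZ, hz⟩ := hconj t
    obtain ⟨hzP, hzσ⟩ := hZ z hzZ
    rw [conj_rewrite Λ w₀ n₂ a act hz y, hf _ hP, hf _ hzP, hzσ, one_mul]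
  rw [hunfold (Λ a * y), hint, integral_const_mul, hscale (fun t => f (w₀ * n₂ t * y)), hunfold y]
  ring

/-- **the unipotent case**: if moreover `m = 1` (no scaling: `act` preserves `μ`) and `σ(w₀ Λ(u) w₀⁻¹) = 1`, then `F(Λ(u) · y) = F(y)`.
[cite: MoeglinWaldspurger1995, II.1.7] -/
theorem inner_law_of_unfold_of_sigma_eq_one (μ : Measure A₀) (Λ : G →* H) (w₀ : H) (n₂ : A₀ → H) (f F : H → ℂ) (c : ℂ)
    (hunfold : ∀ y, F y = c * ∫ t, f (w₀ * n₂ t * y) ∂μ)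
    (σ : H → ℂ) (P : Set H) (hf : ∀ p ∈ P, ∀ h, f (p * h) = σ p * f h)
    (Z : Set H) (hZ : ∀ z ∈ Z, w₀ * z * w₀⁻¹ ∈ P ∧ σ (w₀ * z * w₀⁻¹) = 1)
    (u : G) (act : A₀ → A₀) (hconj : ∀ t, ∃ z ∈ Z, (Λ u)⁻¹ * n₂ t * Λ u = z * n₂ (act t))
    (hscale : ∀ φ : A₀ → ℂ, ∫ t, φ (act t) ∂μ = ∫ t, φ t ∂μ) (hP : w₀ * Λ u * w₀⁻¹ ∈ P) (hσ : σ (w₀ * Λ u * w₀⁻¹) = 1) (y : H) :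
    F (Λ u * y) = F y := by
  rw [inner_law_of_unfold μ Λ w₀ n₂ f F c hunfold σ P hf Z hZ u act 1 hconj (fun φ => by rw [hscale φ, one_mul]) hP y, hσ, one_mul, one_mul]

/-- the same when `Λ(u)` commutes with the corner coordinate on the nose (`z_t = 1`, `act = id`; `1 ∈ Z` is not even needed). [cite: MoeglinWaldspurger1995, II.1.7] -/
theorem inner_law_of_unfold_of_commute (μ : Measure A₀) (Λ : G →* H) (w₀ : H) (n₂ : A₀ → H) (f F : H → ℂ) (c : ℂ)
    (hunfold : ∀ y, F y = c * ∫ t, f (w₀ * n₂ t * y) ∂μ)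
    (σ : H → ℂ) (P : Set H) (hf : ∀ p ∈ P, ∀ h, f (p * h) = σ p * f h)
    (u : G) (hcomm : ∀ t, n₂ t * Λ u = Λ u * n₂ t) (hP : w₀ * Λ u * w₀⁻¹ ∈ P) (hσ : σ (w₀ * Λ u * w₀⁻¹) = 1) (y : H) :
    F (Λ u * y) = F y := by
  have hint : (fun t => f (w₀ * n₂ t * (Λ u * y))) = fun t => f (w₀ * n₂ t * y) := by
    funext t
    have h1 : w₀ * n₂ t * (Λ u * y) = (w₀ * Λ u * w₀⁻¹) * (w₀ * n₂ t * y) := by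
      calc w₀ * n₂ t * (Λ u * y) = w₀ * (n₂ t * Λ u) * y := by group
        _ = w₀ * (Λ u * n₂ t) * y := by rw [hcomm t]
        _ = (w₀ * Λ u * w₀⁻¹) * (w₀ * n₂ t * y) := by group
    rw [h1, hf _ hP, hσ, one_mul]
  rw [hunfold (Λ u * y), hint, hunfold y]

end Abstract

/-! ## §2 Untwisting the `GL₂(𝔸)` torus law by the central character `ξ∘det` -/

section Untwist

variable {L : Type} [Field L] [NumberField L]

/-- the determinant of `diag(d) · g` as a unit. [folklore] -/
theorem det_glDiagonal_mul (d : Fin 2 → (AdeleRing (𝓞 L) L)ˣ) (g : GL (Fin 2) (AdeleRing (𝓞 L) L)) :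
    Matrix.GeneralLinearGroup.det (glDiagonal 2 (AdeleRing (𝓞 L) L) d * g) = d 0 * d 1 * Matrix.GeneralLinearGroup.det g := by
  rw [map_mul, det_glDiagonal_two]

/-- **UNTWISTING THE TORUS LAW**: if `φ₀(diag(d)·g) = ξ(d₀)ξ(d₁) · |d₀|^{s+½}|d₁|^{−(s+½)} · φ₀(g)` for a character `ξ` of the ideles, then `ψ = ξ(det ·)⁻¹ · φ₀` satisfies the
FLAT torus law of ★ (β) `exists_godement_exhaust_of_flat` (`hT`, exponents `(s+½, −(s+½))`, no character). [cite: Bump1997, §3.7] [cite: MoeglinWaldspurger1995, II.1.7] -/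
theorem untwist_torus_law (ξ : (AdeleRing (𝓞 L) L)ˣ →* ℂˣ) (s : ℂ) (φ₀ ψ : GL (Fin 2) (AdeleRing (𝓞 L) L) → ℂ)
    (hψ : ∀ g, ψ g = (((ξ (Matrix.GeneralLinearGroup.det g))⁻¹ : ℂˣ) : ℂ) * φ₀ g)
    (h : ∀ (d : Fin 2 → (AdeleRing (𝓞 L) L)ˣ) (g : GL (Fin 2) (AdeleRing (𝓞 L) L)),
      φ₀ (glDiagonal 2 (AdeleRing (𝓞 L) L) d * g) = ((ξ (d 0) * ξ (d 1) : ℂˣ) : ℂ) *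
        (((IdeleClassGroup.ideleNorm L (d 0) : ℝ) : ℂ) ^ (s + 1 / 2) * ((IdeleClassGroup.ideleNorm L (d 1) : ℝ) : ℂ) ^ (-(s + 1 / 2))) * φ₀ g)
    (d : Fin 2 → (AdeleRing (𝓞 L) L)ˣ) (g : GL (Fin 2) (AdeleRing (𝓞 L) L)) :
    ψ (glDiagonal 2 (AdeleRing (𝓞 L) L) d * g) =
      ((IdeleClassGroup.ideleNorm L (d 0) : ℝ) : ℂ) ^ (s + 1 / 2) * ((IdeleClassGroup.ideleNorm L (d 1) : ℝ) : ℂ) ^ (-(s + 1 / 2)) * ψ g := by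
  rw [hψ, hψ g, h d g, det_glDiagonal_mul, map_mul, map_mul, mul_inv, mul_inv]
  have h0 : ((ξ (d 0) : ℂˣ) : ℂ) ≠ 0 := Units.ne_zero _
  have h1 : ((ξ (d 1) : ℂˣ) : ℂ) ≠ 0 := Units.ne_zero _
  simp only [Units.val_mul, Units.val_inv_eq_inv_val]
  field_simp

/-- **UNTWISTING, UNIPOTENT PART**: `det u = 1` for the unipotents of the Borel, so `ψ = ξ(det ·)⁻¹ · φ₀` inherits `φ₀`'s unipotent invariance (★ (β)'s `hN`). [cite: Bump1997, §3.7] -/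
theorem untwist_unipotent_law (ξ : (AdeleRing (𝓞 L) L)ˣ →* ℂˣ) (φ₀ ψ : GL (Fin 2) (AdeleRing (𝓞 L) L) → ℂ)
    (hψ : ∀ g, ψ g = (((ξ (Matrix.GeneralLinearGroup.det g))⁻¹ : ℂˣ) : ℂ) * φ₀ g)
    (h : ∀ u g : GL (Fin 2) (AdeleRing (𝓞 L) L), (u : Matrix (Fin 2) (Fin 2) (AdeleRing (𝓞 L) L)) 1 0 = 0 →
      (u : Matrix (Fin 2) (Fin 2) (AdeleRing (𝓞 L) L)) 0 0 = 1 → (u : Matrix (Fin 2) (Fin 2) (AdeleRing (𝓞 L) L)) 1 1 = 1 → φ₀ (u * g) = φ₀ g)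
    (u g : GL (Fin 2) (AdeleRing (𝓞 L) L)) (hu10 : (u : Matrix (Fin 2) (Fin 2) (AdeleRing (𝓞 L) L)) 1 0 = 0)
    (hu00 : (u : Matrix (Fin 2) (Fin 2) (AdeleRing (𝓞 L) L)) 0 0 = 1) (hu11 : (u : Matrix (Fin 2) (Fin 2) (AdeleRing (𝓞 L) L)) 1 1 = 1) :
    ψ (u * g) = ψ g := by
  rw [hψ, hψ g, h u g hu10 hu00 hu11, map_mul, det_eq_one_of_unipotent hu10 hu00 hu11, one_mul]

/-- **EXPONENT BOOKKEEPING** `(s+1, −s) = |·|^{½} ⊗ (s+½, −(s+½))`: for positive reals `N₀, N₁`,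
`N₀^{s+1} · N₁^{−s} = (N₀^{½} · N₁^{½}) · (N₀^{s+½} · N₁^{−(s+½)})` (CENSUS-41 §8 «`(s′+1, −s′)`, `s = s′ + ½`»). [folklore] -/
theorem cpow_shift_half {N₀ N₁ : ℝ} (h0 : 0 < N₀) (h1 : 0 < N₁) (s : ℂ) :
    (N₀ : ℂ) ^ (s + 1) * (N₁ : ℂ) ^ (-s) = ((N₀ : ℂ) ^ (1 / 2 : ℂ) * (N₁ : ℂ) ^ (1 / 2 : ℂ)) * ((N₀ : ℂ) ^ (s + 1 / 2) * (N₁ : ℂ) ^ (-(s + 1 / 2))) := by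
  have h0' : (N₀ : ℂ) ≠ 0 := Complex.ofReal_ne_zero.2 h0.ne'
  have h1' : (N₁ : ℂ) ≠ 0 := Complex.ofReal_ne_zero.2 h1.ne'
  calc (N₀ : ℂ) ^ (s + 1) * (N₁ : ℂ) ^ (-s)
      = (N₀ : ℂ) ^ ((1 / 2 : ℂ) + (s + 1 / 2)) * (N₁ : ℂ) ^ ((1 / 2 : ℂ) + (-(s + 1 / 2))) := by congr 1 <;> congr 1 <;> ring
    _ = ((N₀ : ℂ) ^ (1 / 2 : ℂ) * (N₁ : ℂ) ^ (1 / 2 : ℂ)) * ((N₀ : ℂ) ^ (s + 1 / 2) * (N₁ : ℂ) ^ (-(s + 1 / 2))) := by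
        rw [Complex.cpow_add _ _ h0', Complex.cpow_add _ _ h1']
        ring

/-- the idele norms are positive (for `cpow_shift_half`). [folklore] -/
theorem ideleNorm_coe_pos (x : (AdeleRing (𝓞 L) L)ˣ) : 0 < (IdeleClassGroup.ideleNorm L x : ℝ) :=
  NNReal.coe_pos.2 (pos_iff_ne_zero.2 (ideleNorm_ne_zero x))

end Untwist

end Summit.HodgeConjecture.HodgeConjecture.Cruxes.HLiu418.K2LiuMiddleInnerSectionBorelLaw

end
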